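import Mathlib
import HarnessLib
import Summits.Ventures.LatticeQCDFlow.Exactness.SU2FTHMCGaugeCovariance
import Summits.Ventures.LatticeQCDFlow.Exactness.SU2AcceptanceLatticeGaugeErgodic

/-!
# Gauge covariance of the `SU(2)` FT-HMC kernel through the members as the engine packages them — any schedule of layers; the row's 4⁴ acceptance configuration verbatim

HONEST FRAMING: exact (Metropolis-corrected) sampling algorithms for lattice gauge theory;
figures of merit are autocorrelation/cost numbers at stated couplings and volumes; no
continuum-physics claim.

Venture `LatticeQCDFlow` (cell pub-lqcd), topic `Exactness`; FANOUT row 14 (`eng-flowhmc`; members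
`maps.wilson_flow_lo` / `maps.residual_trained_scan` = `lax.scan` over layer specs with a running
`logdet`, packaged in the tree as lists `layers` of (measurable equivalence, booked density) by
`exists_layers_su2WilsonFlowLO` / `exists_layers_su2Residual`).  NEW WORK of the cell; nothing is
cited as a fact; no number.  `SU2FTHMCGaugeCovariance.su2_fthmc_conjKernel_gaugeTransform` is
specialised to the packaging:

* `measurable_foldr_logDet` — the running log-det of layers with measurable densities is measurable;
* **`su2_fthmc_conjKernel_gaugeTransform_layers`** — for ANY list of layers whose composite
  `F_n ∘ ⋯ ∘ F_1` is gauge equivariant with gauge-invariant running log-det (the LO member by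
  `su2WilsonFlowLO_member_gauge`, the learned residual member with invariant weights by
  `su2Residual_member_gauge`), the FT-HMC kernel through the member commutes with every gauge
  transformation (invariant measurable `S`, covariant measurable force, any `c`, `n`);
* **`su2_fthmc_acceptanceLattice_gaugeCovariant`** — THE ROW'S ACCEPTANCE CONFIGURATION: 4⁴ `SU(2)`,
  parity masks, Lüscher's sweep schedule (`8·nsweeps` masked Wilson-flow sub-steps), refusal rule
  `6|ε| < 1`; the LO member so packaged (formulas verbatim as in
  `SU2AcceptanceLatticeGaugeErgodic`) drives an FT-HMC kernel commuting with EVERY gauge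
  transformation `h : Λ → SU(2)`, for every gauge-invariant measurable action, covariant measurable
  force routine, `c`, and trajectory length `n`.

NOT CLAIMED: covariance of the engine's autodiff force routine (hypothesis); `SU(N ≥ 3)`; any number.
-/

noncomputable section

namespace Summit.Ventures.LatticeQCDFlow.Exactness

open WithLp Set MeasureTheory InnerProductGeometry
open ProbabilityTheory ProbabilityTheory.Kernel
open Literature.MathematicalPhysics.QuantumFieldTheory Literature.Barriers.QuantumFields
open scoped ENNReal Matrix

/-! ## Members as the engine packages them -/

section Members

variable {d L : ℕ} [NeZero L]

/-- The running log-det of a list of layers with measurable booked densities is measurable. -/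
theorem measurable_foldr_logDet {Ω : Type*} [MeasurableSpace Ω] (layers : List ((Ω ≃ᵐ Ω) × (Ω → ℝ)))
    (hmeas : ∀ Ly ∈ layers, Measurable Ly.2) :
    Measurable (layers.foldr (fun Ly K => fun v => Ly.2 v * K (Ly.1 v)) (fun _ => (1 : ℝ))) := by
  induction layers with
  | nil => exact measurable_const
  | cons Ly rest ih =>
    rw [List.foldr_cons]
    exact (hmeas Ly List.mem_cons_self).mul
      ((ih fun L hL => hmeas L (List.mem_cons_of_mem _ hL)).comp Ly.1.measurable)

/-- **Schedules of layers.**  For ANY list `layers` of (measurable equivalence, booked density)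
whose composite `F_n ∘ ⋯ ∘ F_1` is gauge equivariant with gauge-invariant running log-det (the LO
Wilson-flow member by `su2WilsonFlowLO_member_gauge`, the learned residual member with invariant
weights by `su2Residual_member_gauge`) and measurable densities, the FT-HMC kernel through the
member commutes with every gauge transformation — invariant measurable `S`, covariant measurable
force, any `c`, `n`. -/
theorem su2_fthmc_conjKernel_gaugeTransform_layers (h : Site d L → Matrix.specialUnitaryGroup (Fin 2) ℂ)
    (layers : List ((GaugeConfig d L (Matrix.specialUnitaryGroup (Fin 2) ℂ) ≃ᵐ GaugeConfig d L (Matrix.specialUnitaryGroup (Fin 2) ℂ)) × (GaugeConfig d L (Matrix.specialUnitaryGroup (Fin 2) ℂ) → ℝ)))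
    (hmeas : ∀ Ly ∈ layers, Measurable Ly.2)
    (hFeq : IsGaugeEquivariant (⇑(layers.foldr (fun Ly (G : GaugeConfig d L (Matrix.specialUnitaryGroup (Fin 2) ℂ) ≃ᵐ GaugeConfig d L (Matrix.specialUnitaryGroup (Fin 2) ℂ)) => Ly.1.trans G)
              (MeasurableEquiv.refl (GaugeConfig d L (Matrix.specialUnitaryGroup (Fin 2) ℂ))))))
    (hJinv : IsGaugeInvariant (layers.foldr (fun Ly K => fun V => Ly.2 V * K (Ly.1 V)) (fun _ => (1 : ℝ))))
    {S : GaugeConfig d L (Matrix.specialUnitaryGroup (Fin 2) ℂ) → ℝ} (hS : Measurable S) (hSi : IsGaugeInvariant S) (c : ℝ)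
    {g : GaugeConfig d L (Matrix.specialUnitaryGroup (Fin 2) ℂ) → ((Edge d L × Fin 3) → ℝ)} (hg : Measurable g)
    (hgc : ∀ V : GaugeConfig d L (Matrix.specialUnitaryGroup (Fin 2) ℂ), g (gaugeTransform h V) =
      (fun q : Edge d L × Fin 3 => (vecQuat (((h q.1.1 : Matrix.specialUnitaryGroup (Fin 2) ℂ) : Matrix (Fin 2) (Fin 2) ℂ) * quatVec (toLp 2 ![0, g V (q.1, 0), g V (q.1, 1), g V (q.1, 2)]) * (((h q.1.1 : Matrix.specialUnitaryGroup (Fin 2) ℂ) : Matrix (Fin 2) (Fin 2) ℂ))ᴴ)) q.2.succ)) (n : ℕ) :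
    conjKernel
      (conjKernel
        (refreshUpdate
          (involMH
            (⇑((flip : Equiv.Perm (GaugeConfig d L (Matrix.specialUnitaryGroup (Fin 2) ℂ) × ((Edge d L × Fin 3) → ℝ))) *
                leapfrog (mulDrift fun p : ((Edge d L × Fin 3) → ℝ) =>
                  fun ℓ : Edge d L => gaussUnit (toLp 2
          ![Real.cos (c * Real.sqrt (p (ℓ, 0) ^ 2 + p (ℓ, 1) ^ 2 + p (ℓ, 2) ^ 2)),
            c * Real.sinc (c * Real.sqrt (p (ℓ, 0) ^ 2 + p (ℓ, 1) ^ 2 + p (ℓ, 2) ^ 2)) * p (ℓ, 0),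
            c * Real.sinc (c * Real.sqrt (p (ℓ, 0) ^ 2 + p (ℓ, 1) ^ 2 + p (ℓ, 2) ^ 2)) * p (ℓ, 1),
            c * Real.sinc (c * Real.sqrt (p (ℓ, 0) ^ 2 + p (ℓ, 1) ^ 2 + p (ℓ, 2) ^ 2)) * p (ℓ, 2)])) g ^ n))
            (measurable_flip_leapfrog_pow (measurable_mulDrift (measurable_su2Drift c)) hg n)
            fun z : GaugeConfig d L (Matrix.specialUnitaryGroup (Fin 2) ℂ) × ((Edge d L × Fin 3) → ℝ) =>
              (S ((layers.foldr (fun Ly (G : GaugeConfig d L (Matrix.specialUnitaryGroup (Fin 2) ℂ) ≃ᵐ GaugeConfig d L (Matrix.specialUnitaryGroup (Fin 2) ℂ)) => Ly.1.trans G)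
              (MeasurableEquiv.refl (GaugeConfig d L (Matrix.specialUnitaryGroup (Fin 2) ℂ)))) z.1) - Real.log ((layers.foldr (fun Ly K => fun V => Ly.2 V * K (Ly.1 V)) (fun _ => (1 : ℝ))) z.1)) + ∑ i, z.2 i ^ 2 / 2)
          ((((volume : Measure ((Edge d L × Fin 3) → ℝ)).withDensity
                  fun p => ENNReal.ofReal (Real.exp (-(∑ i, p i ^ 2 / 2)))) Set.univ)⁻¹ •
              (volume : Measure ((Edge d L × Fin 3) → ℝ)).withDensity
                fun p => ENNReal.ofReal (Real.exp (-(∑ i, p i ^ 2 / 2)))))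
        (layers.foldr (fun Ly (G : GaugeConfig d L (Matrix.specialUnitaryGroup (Fin 2) ℂ) ≃ᵐ GaugeConfig d L (Matrix.specialUnitaryGroup (Fin 2) ℂ)) => Ly.1.trans G)
              (MeasurableEquiv.refl (GaugeConfig d L (Matrix.specialUnitaryGroup (Fin 2) ℂ)))))
      (Elitzur.gaugeTransformMEquiv h) =
      (conjKernel
        (refreshUpdate
          (involMH
            (⇑((flip : Equiv.Perm (GaugeConfig d L (Matrix.specialUnitaryGroup (Fin 2) ℂ) × ((Edge d L × Fin 3) → ℝ))) *
                leapfrog (mulDrift fun p : ((Edge d L × Fin 3) → ℝ) =>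
                  fun ℓ : Edge d L => gaussUnit (toLp 2
          ![Real.cos (c * Real.sqrt (p (ℓ, 0) ^ 2 + p (ℓ, 1) ^ 2 + p (ℓ, 2) ^ 2)),
            c * Real.sinc (c * Real.sqrt (p (ℓ, 0) ^ 2 + p (ℓ, 1) ^ 2 + p (ℓ, 2) ^ 2)) * p (ℓ, 0),
            c * Real.sinc (c * Real.sqrt (p (ℓ, 0) ^ 2 + p (ℓ, 1) ^ 2 + p (ℓ, 2) ^ 2)) * p (ℓ, 1),
            c * Real.sinc (c * Real.sqrt (p (ℓ, 0) ^ 2 + p (ℓ, 1) ^ 2 + p (ℓ, 2) ^ 2)) * p (ℓ, 2)])) g ^ n))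
            (measurable_flip_leapfrog_pow (measurable_mulDrift (measurable_su2Drift c)) hg n)
            fun z : GaugeConfig d L (Matrix.specialUnitaryGroup (Fin 2) ℂ) × ((Edge d L × Fin 3) → ℝ) =>
              (S ((layers.foldr (fun Ly (G : GaugeConfig d L (Matrix.specialUnitaryGroup (Fin 2) ℂ) ≃ᵐ GaugeConfig d L (Matrix.specialUnitaryGroup (Fin 2) ℂ)) => Ly.1.trans G)
              (MeasurableEquiv.refl (GaugeConfig d L (Matrix.specialUnitaryGroup (Fin 2) ℂ)))) z.1) - Real.log ((layers.foldr (fun Ly K => fun V => Ly.2 V * K (Ly.1 V)) (fun _ => (1 : ℝ))) z.1)) + ∑ i, z.2 i ^ 2 / 2)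
          ((((volume : Measure ((Edge d L × Fin 3) → ℝ)).withDensity
                  fun p => ENNReal.ofReal (Real.exp (-(∑ i, p i ^ 2 / 2)))) Set.univ)⁻¹ •
              (volume : Measure ((Edge d L × Fin 3) → ℝ)).withDensity
                fun p => ENNReal.ofReal (Real.exp (-(∑ i, p i ^ 2 / 2)))))
        (layers.foldr (fun Ly (G : GaugeConfig d L (Matrix.specialUnitaryGroup (Fin 2) ℂ) ≃ᵐ GaugeConfig d L (Matrix.specialUnitaryGroup (Fin 2) ℂ)) => Ly.1.trans G)
              (MeasurableEquiv.refl (GaugeConfig d L (Matrix.specialUnitaryGroup (Fin 2) ℂ))))) :=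
  su2_fthmc_conjKernel_gaugeTransform h _ hFeq (measurable_foldr_logDet layers hmeas) hJinv hS hSi c hg hgc n

/-- **The row's acceptance configuration, verbatim.**  On the 4⁴ `SU(2)` lattice with parity masks,
Lüscher's sweep schedule (`8·nsweeps` masked Wilson-flow sub-steps) and the refusal rule `6|ε| < 1`,
the LO member packaged as in `exists_layers_su2WilsonFlowLO` drives an FT-HMC kernel that commutes
with EVERY gauge transformation `h : Λ → SU(2)`, for every gauge-invariant measurable action `S`,
every covariant measurable force routine `g`, every `c` and trajectory length `n`. -/
theorem su2_fthmc_acceptanceLattice_gaugeCovariant {ε : ℝ} (hε : |ε| * 6 < 1) (nsweeps : ℕ) :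
    ∃ χ : Site 4 4 → ZMod 2, (∀ (x : Site 4 4) (i : Fin 4), χ (x.shift i) ≠ χ x) ∧
    ∃ layers : List ((GaugeConfig 4 4 (Matrix.specialUnitaryGroup (Fin 2) ℂ) ≃ᵐ GaugeConfig 4 4 (Matrix.specialUnitaryGroup (Fin 2) ℂ)) × (GaugeConfig 4 4 (Matrix.specialUnitaryGroup (Fin 2) ℂ) → ℝ)),
      layers.map (fun Ly => ((Ly.1 : GaugeConfig 4 4 (Matrix.specialUnitaryGroup (Fin 2) ℂ) → GaugeConfig 4 4 (Matrix.specialUnitaryGroup (Fin 2) ℂ)), Ly.2)) =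
        ((List.replicate nsweeps ((List.finRange 4).flatMap fun μ : Fin 4 => [(μ, (0 : ZMod 2)), (μ, 1)])).flatten).map (fun s =>
        ((fun (V : GaugeConfig 4 4 (Matrix.specialUnitaryGroup (Fin 2) ℂ)) (e : Edge 4 4) =>
        if e.2 = s.1 ∧ χ e.1 = s.2 then
          gaussUnit (geodesicKick ε (∑ ν ∈ Finset.univ.erase e.2,
            (vecQuat (((V (Site.shift e.1 e.2, ν) * (V (Site.shift e.1 ν, e.2))⁻¹ * (V (e.1, ν))⁻¹)⁻¹ : (Matrix.specialUnitaryGroup (Fin 2) ℂ)) : Matrix (Fin 2) (Fin 2) ℂ) +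
              vecQuat ((((V (Site.shift (e.1 - Pi.single ν 1) e.2, ν))⁻¹ * (V (e.1 - Pi.single ν 1, e.2))⁻¹ *
                V (e.1 - Pi.single ν 1, ν))⁻¹ : (Matrix.specialUnitaryGroup (Fin 2) ℂ)) : Matrix (Fin 2) (Fin 2) ℂ)))
            (vecQuat ((V e : (Matrix.specialUnitaryGroup (Fin 2) ℂ)) : Matrix (Fin 2) (Fin 2) ℂ)))
        else V e),
         fun V : GaugeConfig 4 4 (Matrix.specialUnitaryGroup (Fin 2) ℂ) => ∏ a : {e : Edge 4 4 // e.2 = s.1 ∧ χ e.1 = s.2},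
          (if Real.sin (angle (∑ ν ∈ Finset.univ.erase a.1.2,
            (vecQuat (((V (Site.shift a.1.1 a.1.2, ν) * (V (Site.shift a.1.1 ν, a.1.2))⁻¹ * (V (a.1.1, ν))⁻¹)⁻¹ : (Matrix.specialUnitaryGroup (Fin 2) ℂ)) : Matrix (Fin 2) (Fin 2) ℂ) +
              vecQuat ((((V (Site.shift (a.1.1 - Pi.single ν 1) a.1.2, ν))⁻¹ * (V (a.1.1 - Pi.single ν 1, a.1.2))⁻¹ *
                V (a.1.1 - Pi.single ν 1, ν))⁻¹ : (Matrix.specialUnitaryGroup (Fin 2) ℂ)) : Matrix (Fin 2) (Fin 2) ℂ))) (vecQuat ((V a.1 : (Matrix.specialUnitaryGroup (Fin 2) ℂ)) : Matrix (Fin 2) (Fin 2) ℂ))) = 0 then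
            (1 - ε * ‖(∑ ν ∈ Finset.univ.erase a.1.2,
            (vecQuat (((V (Site.shift a.1.1 a.1.2, ν) * (V (Site.shift a.1.1 ν, a.1.2))⁻¹ * (V (a.1.1, ν))⁻¹)⁻¹ : (Matrix.specialUnitaryGroup (Fin 2) ℂ)) : Matrix (Fin 2) (Fin 2) ℂ) +
              vecQuat ((((V (Site.shift (a.1.1 - Pi.single ν 1) a.1.2, ν))⁻¹ * (V (a.1.1 - Pi.single ν 1, a.1.2))⁻¹ *
                V (a.1.1 - Pi.single ν 1, ν))⁻¹ : (Matrix.specialUnitaryGroup (Fin 2) ℂ)) : Matrix (Fin 2) (Fin 2) ℂ)))‖ * Real.cos (angle (∑ ν ∈ Finset.univ.erase a.1.2,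
            (vecQuat (((V (Site.shift a.1.1 a.1.2, ν) * (V (Site.shift a.1.1 ν, a.1.2))⁻¹ * (V (a.1.1, ν))⁻¹)⁻¹ : (Matrix.specialUnitaryGroup (Fin 2) ℂ)) : Matrix (Fin 2) (Fin 2) ℂ) +
              vecQuat ((((V (Site.shift (a.1.1 - Pi.single ν 1) a.1.2, ν))⁻¹ * (V (a.1.1 - Pi.single ν 1, a.1.2))⁻¹ *
                V (a.1.1 - Pi.single ν 1, ν))⁻¹ : (Matrix.specialUnitaryGroup (Fin 2) ℂ)) : Matrix (Fin 2) (Fin 2) ℂ))) (vecQuat ((V a.1 : (Matrix.specialUnitaryGroup (Fin 2) ℂ)) : Matrix (Fin 2) (Fin 2) ℂ)))) ^ 3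
          else kickJac (ε * ‖(∑ ν ∈ Finset.univ.erase a.1.2,
            (vecQuat (((V (Site.shift a.1.1 a.1.2, ν) * (V (Site.shift a.1.1 ν, a.1.2))⁻¹ * (V (a.1.1, ν))⁻¹)⁻¹ : (Matrix.specialUnitaryGroup (Fin 2) ℂ)) : Matrix (Fin 2) (Fin 2) ℂ) +
              vecQuat ((((V (Site.shift (a.1.1 - Pi.single ν 1) a.1.2, ν))⁻¹ * (V (a.1.1 - Pi.single ν 1, a.1.2))⁻¹ *
                V (a.1.1 - Pi.single ν 1, ν))⁻¹ : (Matrix.specialUnitaryGroup (Fin 2) ℂ)) : Matrix (Fin 2) (Fin 2) ℂ)))‖) 2 (angle (∑ ν ∈ Finset.univ.erase a.1.2,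
            (vecQuat (((V (Site.shift a.1.1 a.1.2, ν) * (V (Site.shift a.1.1 ν, a.1.2))⁻¹ * (V (a.1.1, ν))⁻¹)⁻¹ : (Matrix.specialUnitaryGroup (Fin 2) ℂ)) : Matrix (Fin 2) (Fin 2) ℂ) +
              vecQuat ((((V (Site.shift (a.1.1 - Pi.single ν 1) a.1.2, ν))⁻¹ * (V (a.1.1 - Pi.single ν 1, a.1.2))⁻¹ *
                V (a.1.1 - Pi.single ν 1, ν))⁻¹ : (Matrix.specialUnitaryGroup (Fin 2) ℂ)) : Matrix (Fin 2) (Fin 2) ℂ))) (vecQuat ((V a.1 : (Matrix.specialUnitaryGroup (Fin 2) ℂ)) : Matrix (Fin 2) (Fin 2) ℂ)))))) ∧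
      layers.length = 8 * nsweeps ∧
      ∀ (h : Site 4 4 → Matrix.specialUnitaryGroup (Fin 2) ℂ) {S : GaugeConfig 4 4 (Matrix.specialUnitaryGroup (Fin 2) ℂ) → ℝ} (hS : Measurable S) (_hSi : IsGaugeInvariant S) (c : ℝ)
        {g : GaugeConfig 4 4 (Matrix.specialUnitaryGroup (Fin 2) ℂ) → ((Edge 4 4 × Fin 3) → ℝ)} (hg : Measurable g)
        (_hgc : ∀ V : GaugeConfig 4 4 (Matrix.specialUnitaryGroup (Fin 2) ℂ), g (gaugeTransform h V) =
          (fun q : Edge 4 4 × Fin 3 => (vecQuat (((h q.1.1 : Matrix.specialUnitaryGroup (Fin 2) ℂ) : Matrix (Fin 2) (Fin 2) ℂ) * quatVec (toLp 2 ![0, g V (q.1, 0), g V (q.1, 1), g V (q.1, 2)]) * (((h q.1.1 : Matrix.specialUnitaryGroup (Fin 2) ℂ) : Matrix (Fin 2) (Fin 2) ℂ))ᴴ)) q.2.succ)) (n : ℕ),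
      conjKernel
        (conjKernel
          (refreshUpdate
            (involMH
              (⇑((flip : Equiv.Perm (GaugeConfig 4 4 (Matrix.specialUnitaryGroup (Fin 2) ℂ) × ((Edge 4 4 × Fin 3) → ℝ))) *
                  leapfrog (mulDrift fun p : ((Edge 4 4 × Fin 3) → ℝ) =>
                    fun ℓ : Edge 4 4 => gaussUnit (toLp 2
          ![Real.cos (c * Real.sqrt (p (ℓ, 0) ^ 2 + p (ℓ, 1) ^ 2 + p (ℓ, 2) ^ 2)),
            c * Real.sinc (c * Real.sqrt (p (ℓ, 0) ^ 2 + p (ℓ, 1) ^ 2 + p (ℓ, 2) ^ 2)) * p (ℓ, 0),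
            c * Real.sinc (c * Real.sqrt (p (ℓ, 0) ^ 2 + p (ℓ, 1) ^ 2 + p (ℓ, 2) ^ 2)) * p (ℓ, 1),
            c * Real.sinc (c * Real.sqrt (p (ℓ, 0) ^ 2 + p (ℓ, 1) ^ 2 + p (ℓ, 2) ^ 2)) * p (ℓ, 2)])) g ^ n))
              (measurable_flip_leapfrog_pow (measurable_mulDrift (measurable_su2Drift c)) hg n)
              fun z : GaugeConfig 4 4 (Matrix.specialUnitaryGroup (Fin 2) ℂ) × ((Edge 4 4 × Fin 3) → ℝ) =>
                (S ((layers.foldr (fun Ly (G : GaugeConfig 4 4 (Matrix.specialUnitaryGroup (Fin 2) ℂ) ≃ᵐ GaugeConfig 4 4 (Matrix.specialUnitaryGroup (Fin 2) ℂ)) => Ly.1.trans G)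
              (MeasurableEquiv.refl (GaugeConfig 4 4 (Matrix.specialUnitaryGroup (Fin 2) ℂ)))) z.1) - Real.log ((layers.foldr (fun Ly K => fun V => Ly.2 V * K (Ly.1 V)) (fun _ => (1 : ℝ))) z.1)) + ∑ i, z.2 i ^ 2 / 2)
            ((((volume : Measure ((Edge 4 4 × Fin 3) → ℝ)).withDensity
                  fun p => ENNReal.ofReal (Real.exp (-(∑ i, p i ^ 2 / 2)))) Set.univ)⁻¹ •
              (volume : Measure ((Edge 4 4 × Fin 3) → ℝ)).withDensity
                fun p => ENNReal.ofReal (Real.exp (-(∑ i, p i ^ 2 / 2)))))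
          (layers.foldr (fun Ly (G : GaugeConfig 4 4 (Matrix.specialUnitaryGroup (Fin 2) ℂ) ≃ᵐ GaugeConfig 4 4 (Matrix.specialUnitaryGroup (Fin 2) ℂ)) => Ly.1.trans G)
              (MeasurableEquiv.refl (GaugeConfig 4 4 (Matrix.specialUnitaryGroup (Fin 2) ℂ)))))
        (Elitzur.gaugeTransformMEquiv h) =
        (conjKernel
          (refreshUpdate
            (involMH
              (⇑((flip : Equiv.Perm (GaugeConfig 4 4 (Matrix.specialUnitaryGroup (Fin 2) ℂ) × ((Edge 4 4 × Fin 3) → ℝ))) *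
                  leapfrog (mulDrift fun p : ((Edge 4 4 × Fin 3) → ℝ) =>
                    fun ℓ : Edge 4 4 => gaussUnit (toLp 2
          ![Real.cos (c * Real.sqrt (p (ℓ, 0) ^ 2 + p (ℓ, 1) ^ 2 + p (ℓ, 2) ^ 2)),
            c * Real.sinc (c * Real.sqrt (p (ℓ, 0) ^ 2 + p (ℓ, 1) ^ 2 + p (ℓ, 2) ^ 2)) * p (ℓ, 0),
            c * Real.sinc (c * Real.sqrt (p (ℓ, 0) ^ 2 + p (ℓ, 1) ^ 2 + p (ℓ, 2) ^ 2)) * p (ℓ, 1),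
            c * Real.sinc (c * Real.sqrt (p (ℓ, 0) ^ 2 + p (ℓ, 1) ^ 2 + p (ℓ, 2) ^ 2)) * p (ℓ, 2)])) g ^ n))
              (measurable_flip_leapfrog_pow (measurable_mulDrift (measurable_su2Drift c)) hg n)
              fun z : GaugeConfig 4 4 (Matrix.specialUnitaryGroup (Fin 2) ℂ) × ((Edge 4 4 × Fin 3) → ℝ) =>
                (S ((layers.foldr (fun Ly (G : GaugeConfig 4 4 (Matrix.specialUnitaryGroup (Fin 2) ℂ) ≃ᵐ GaugeConfig 4 4 (Matrix.specialUnitaryGroup (Fin 2) ℂ)) => Ly.1.trans G)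
              (MeasurableEquiv.refl (GaugeConfig 4 4 (Matrix.specialUnitaryGroup (Fin 2) ℂ)))) z.1) - Real.log ((layers.foldr (fun Ly K => fun V => Ly.2 V * K (Ly.1 V)) (fun _ => (1 : ℝ))) z.1)) + ∑ i, z.2 i ^ 2 / 2)
            ((((volume : Measure ((Edge 4 4 × Fin 3) → ℝ)).withDensity
                  fun p => ENNReal.ofReal (Real.exp (-(∑ i, p i ^ 2 / 2)))) Set.univ)⁻¹ •
              (volume : Measure ((Edge 4 4 × Fin 3) → ℝ)).withDensity
                fun p => ENNReal.ofReal (Real.exp (-(∑ i, p i ^ 2 / 2)))))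
          (layers.foldr (fun Ly (G : GaugeConfig 4 4 (Matrix.specialUnitaryGroup (Fin 2) ℂ) ≃ᵐ GaugeConfig 4 4 (Matrix.specialUnitaryGroup (Fin 2) ℂ)) => Ly.1.trans G)
              (MeasurableEquiv.refl (GaugeConfig 4 4 (Matrix.specialUnitaryGroup (Fin 2) ℂ))))) := by
  obtain ⟨χ, hχ⟩ := exists_parityMask (d := 4) (L := 4) (by decide)
  have hε' : |ε| * (2 * ((4 - 1 : ℕ) : ℝ)) < 1 := by norm_num; linarith
  obtain ⟨layers, hmap, -, hmeas, -⟩ := exists_layers_su2WilsonFlowLO χ hχ hε'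
    ((List.replicate nsweeps ((List.finRange 4).flatMap fun μ : Fin 4 => [(μ, (0 : ZMod 2)), (μ, 1)])).flatten)
  have hgauge := su2WilsonFlowLO_member_gauge χ ε _ layers hmap
  refine ⟨χ, hχ, layers, hmap, ?_, ?_⟩
  · have hl := congrArg List.length hmap
    rw [List.length_map, List.length_map, length_luscherSchedule_four] at hl
    exact hl
  · intro h S hS hSi c g hg hgc n
    exact su2_fthmc_conjKernel_gaugeTransform_layers h layers hmeas hgauge.1 hgauge.2 hS hSi c hg hgc n

end Members

end Summit.Ventures.LatticeQCDFlow.Exactness
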